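import Mathlib
import Literature.Analysis.FluidPDE.LoopCirculation
import HarnessLib

/-!
# Route `TautLoopKelvin`, crux `TautLoopLaw` (stmt-NavierStokesRegularity-15249),
  line `Sketch-ideas-r1k1` — tools for the stub `stub_tautLoopLevelLeftContinuity`, part 1:
  gluing closed `C¹` loops

Elementary `C¹` surgery on closed loops `ℝ → ℝ³` (`Literature.Analysis.FluidPDE.IsC1Loop`:
`C¹` and `1`-periodic), keeping track of the length `len γ = ∫₀¹ ‖γ′‖` and of the circulation
`∮_γ v · dℓ = Literature.Analysis.FluidPDE.circulation v γ` of a continuous field `v`: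

* `tautLoopLlc_hasDerivAt_ite`: two maps with the same value and the same derivative at a point
  glue, whatever the switching predicate, to a map with that derivative there;
* the **stopping reparametrisation** `s ↦ γ (a + s - sin (2πs) / (2π))` of a loop (a `C¹` loop
  with the same length and circulation which rests, with zero velocity, at `γ a` at integer times);
* the **glued loop** `s ↦ if sin (2πs) ≤ 0 then β (2s) else α (2s)` of two loops `α`, `β` resting at
  the common point `α 0 = β 0` at integer times: a `C¹` loop whose length and circulation are the
  sums of those of `α` and `β`;
* shift invariance of the length.

All statements are folklore calculus; everything is proved.
-/

noncomputable section

open Set MeasureTheory Filter Topology Function Real intervalIntegral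
  Literature.Analysis.FluidPDE
open scoped InnerProductSpace RealInnerProductSpace

namespace Summit.NavierStokesRegularity.NavierStokesRegularity.Theorems

set_option linter.dupNamespace false

local notation3 "E3" => EuclideanSpace ℝ (Fin 3)

/-! ## Gluing derivatives -/

/-- **Gluing derivatives.** If `f` and `g` have the same value and the same derivative `f'` at `x`,
then any function which at each point equals either `f` or `g` (switching by an arbitrary predicate)
has derivative `f'` at `x`. [folklore] -/
theorem tautLoopLlc_hasDerivAt_ite {F : Type*} [NormedAddCommGroup F] [NormedSpace ℝ F]
    {f g : ℝ → F} {p : ℝ → Prop} [DecidablePred p] {x : ℝ} {f' : F}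
    (hf : HasDerivAt f f' x) (hg : HasDerivAt g f' x) (heq : f x = g x) :
    HasDerivAt (fun s => if p s then f s else g s) f' x := by
  have hx : (if p x then f x else g x) = f x := by
    by_cases h : p x <;> simp [h, heq]
  rw [hasDerivAt_iff_isLittleO] at hf hg ⊢
  refine Asymptotics.isLittleO_iff.2 fun c hc => ?_
  filter_upwards [hf.def hc, hg.def hc] with y hfy hgy
  rw [hx]
  by_cases hy : p y
  · simpa only [hy, if_true] using hfy
  · rw [heq]
    simpa only [hy, if_false] using hgy

/-! ## Lengths: shift and reparametrisation -/

/-- The length `∫₀¹ ‖γ′‖` of a `1`-periodic curve does not depend on the base point of the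
parametrisation. [folklore] -/
theorem tautLoopLlc_len_comp_add_const {γ : ℝ → E3} (hγ : Periodic γ 1) (a : ℝ) :
    ∫ s in (0:ℝ)..1, ‖deriv (fun s => γ (s + a)) s‖ = ∫ s in (0:ℝ)..1, ‖deriv γ s‖ := by
  have hper : Periodic (fun s => ‖deriv γ s‖) 1 := fun s => by
    simp only [hγ.deriv s]
  have h1 := intervalIntegral.integral_comp_add_right (a := 0) (b := 1) (fun s => ‖deriv γ s‖) a
  simp only [zero_add] at h1
  simp only [deriv_comp_add_const]
  rw [h1, add_comm, hper.intervalIntegral_add_eq a 0, zero_add]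

/-- **Length under monotone reparametrisation**: for a `C¹` curve `γ` and a `C¹` change of
parameter `φ` with `φ′ ≥ 0`, `∫ₐᵇ ‖(γ ∘ φ)′‖ = ∫_{φ a}^{φ b} ‖γ′‖`. [folklore] -/
theorem tautLoopLlc_len_comp_of_deriv_nonneg {γ : ℝ → E3} (hγ : ContDiff ℝ 1 γ) {φ φ' : ℝ → ℝ}
    (hφ : ∀ s, HasDerivAt φ (φ' s) s) (hφ'c : Continuous φ') (hpos : ∀ s, 0 ≤ φ' s) (a b : ℝ) :
    ∫ s in a..b, ‖deriv (γ ∘ φ) s‖ = ∫ u in (φ a)..(φ b), ‖deriv γ u‖ := by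
  have hd : ∀ s, deriv (γ ∘ φ) s = φ' s • deriv γ (φ s) := fun s =>
    ((hγ.differentiable one_ne_zero (φ s)).hasDerivAt.scomp s (hφ s)).deriv
  have h := integral_comp_mul_deriv' (a := a) (b := b) (g := fun u => ‖deriv γ u‖)
    (fun s _ => hφ s) hφ'c.continuousOn (hγ.continuous_deriv le_rfl).norm.continuousOn
  rw [← h]
  refine integral_congr fun s _ => ?_
  simp only [hd s, norm_smul, Real.norm_eq_abs, abs_of_nonneg (hpos s), comp_apply]
  ring

/-! ## The stopping reparametrisation -/

/-- The stopping clock `θ(s) = a + s - sin (2πs) / (2π)` has derivative `1 - cos (2πs)`. [folklore] -/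
theorem tautLoopLlc_hasDerivAt_stopClock (a s : ℝ) :
    HasDerivAt (fun s : ℝ => a + (s - Real.sin (2 * π * s) / (2 * π)))
      (1 - Real.cos (2 * π * s)) s := by
  have hθ : HasDerivAt (fun s : ℝ => 2 * π * s) (2 * π) s := by
    simpa using (hasDerivAt_id s).const_mul (2 * π)
  have hsin : HasDerivAt (fun s : ℝ => Real.sin (2 * π * s) / (2 * π))
      (Real.cos (2 * π * s) * (2 * π) / (2 * π)) s :=
    ((Real.hasDerivAt_sin _).comp s hθ).div_const (2 * π)
  have h := ((hasDerivAt_id s).sub hsin).const_add a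
  refine h.congr_deriv ?_
  have h2π : (2 * π : ℝ) ≠ 0 := by positivity
  simp [h2π]

/-- **The stopping reparametrisation of a loop is a `C¹` loop** resting at `γ a` at time `0`:
`s ↦ γ (a + s - sin (2πs)/(2π))` is `C¹`, `1`-periodic, starts at `γ a` with zero velocity. [folklore] -/
theorem tautLoopLlc_stop_isC1Loop {γ : ℝ → E3} (hγ : IsC1Loop γ) (a : ℝ) :
    IsC1Loop (fun s => γ (a + (s - Real.sin (2 * π * s) / (2 * π)))) ∧
      (fun s => γ (a + (s - Real.sin (2 * π * s) / (2 * π)))) 0 = γ a ∧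
      deriv (fun s => γ (a + (s - Real.sin (2 * π * s) / (2 * π)))) 0 = 0 := by
  refine ⟨⟨hγ.contDiff.comp (by fun_prop), fun s => ?_⟩, by simp, ?_⟩
  · show γ (a + (s + 1 - Real.sin (2 * π * (s + 1)) / (2 * π))) =
      γ (a + (s - Real.sin (2 * π * s) / (2 * π)))
    rw [show 2 * π * (s + 1) = 2 * π * s + 2 * π by ring, Real.sin_add_two_pi,
      show a + (s + 1 - Real.sin (2 * π * s) / (2 * π)) =
        a + (s - Real.sin (2 * π * s) / (2 * π)) + 1 by ring, hγ.periodic]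
  · have h : HasDerivAt (fun s => γ (a + (s - Real.sin (2 * π * s) / (2 * π))))
        ((1 - Real.cos (2 * π * 0)) • deriv γ (a + (0 - Real.sin (2 * π * 0) / (2 * π)))) 0 :=
      ((hγ.differentiable _).hasDerivAt.scomp (0 : ℝ) (tautLoopLlc_hasDerivAt_stopClock a 0))
    rw [h.deriv]
    simp

/-- The stopping reparametrisation does not change the circulation. [folklore] -/
theorem tautLoopLlc_stop_circulation (v : E3 → E3) {γ : ℝ → E3} (hγ : IsC1Loop γ) (a : ℝ) :
    circulation v (fun s => γ (a + (s - Real.sin (2 * π * s) / (2 * π)))) = circulation v γ := by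
  have hfun : (fun s => γ (a + (s - Real.sin (2 * π * s) / (2 * π)))) =
      (fun t => γ (t + a)) ∘ (fun s => 0 + (s - Real.sin (2 * π * s) / (2 * π))) := by
    funext s
    simp only [comp_apply, zero_add]
    rw [add_comm]
  rw [hfun, circulation_comp_eq_of_deriv_nonneg v ((hγ.comp_add_const a).differentiable)
    (φ' := fun s => 1 - Real.cos (2 * π * s)) (by fun_prop)
    (fun s _ => tautLoopLlc_hasDerivAt_stopClock 0 s)
    (fun s _ => by simpa using Real.cos_le_one (2 * π * s)) (by simp) (by simp),
    circulation_comp_add_const v hγ.periodic a]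

/-- The stopping reparametrisation does not change the length. [folklore] -/
theorem tautLoopLlc_stop_len {γ : ℝ → E3} (hγ : IsC1Loop γ) (a : ℝ) :
    ∫ s in (0:ℝ)..1, ‖deriv (fun s => γ (a + (s - Real.sin (2 * π * s) / (2 * π)))) s‖ =
      ∫ s in (0:ℝ)..1, ‖deriv γ s‖ := by
  have hfun : (fun s => γ (a + (s - Real.sin (2 * π * s) / (2 * π)))) =
      (fun t => γ (t + a)) ∘ (fun s => 0 + (s - Real.sin (2 * π * s) / (2 * π))) := by
    funext s
    simp only [comp_apply, zero_add]
    rw [add_comm]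
  rw [hfun, tautLoopLlc_len_comp_of_deriv_nonneg (hγ.comp_add_const a).contDiff
    (fun s => tautLoopLlc_hasDerivAt_stopClock 0 s) (by fun_prop)
    (fun s => by simpa using Real.cos_le_one (2 * π * s)) 0 1]
  simp only [mul_zero, Real.sin_zero, zero_div, sub_zero, zero_add, mul_one, Real.sin_two_pi]
  exact tautLoopLlc_len_comp_add_const hγ.periodic a

/-! ## Gluing two resting loops -/

local notation3 (prettyPrint := false) "glue⟦" α ", " β "⟧" =>
  (fun s : ℝ => if Real.sin (2 * Real.pi * s) ≤ 0 then β (2 * s) else α (2 * s))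

/-- At a junction time `s` (`sin (2πs) = 0`, i.e. `2s ∈ ℤ`) a loop resting at time `0` sits at its
base point with zero velocity. [folklore] -/
theorem tautLoopLlc_junction {α : ℝ → E3} (hα : IsC1Loop α) (hα0 : deriv α 0 = 0) {s : ℝ}
    (hs : Real.sin (2 * π * s) = 0) : α (2 * s) = α 0 ∧ deriv α (2 * s) = 0 := by
  obtain ⟨n, hn⟩ := Real.sin_eq_zero_iff.1 hs
  have h2s : 2 * s = (n : ℝ) := by
    have h' : (2 * s) * π = (n : ℝ) * π := by rw [hn]; ring
    exact mul_right_cancel₀ Real.pi_ne_zero h'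
  refine ⟨?_, ?_⟩
  · rw [h2s]
    simpa using hα.periodic.int_mul_eq n
  · rw [h2s, ← hα0]
    simpa using hα.periodic_deriv.int_mul_eq n

/-- **Velocity of the glued loop.** For two `C¹` loops `α`, `β` resting at the common point
`α 0 = β 0` at time `0`, the glued loop `s ↦ if sin (2πs) ≤ 0 then β (2s) else α (2s)` is
differentiable everywhere, with the glued velocity. [folklore] -/
theorem tautLoopLlc_glue_hasDerivAt {α β : ℝ → E3} (hα : IsC1Loop α) (hβ : IsC1Loop β)
    (h0 : α 0 = β 0) (hα0 : deriv α 0 = 0) (hβ0 : deriv β 0 = 0) (s : ℝ) :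
    HasDerivAt (glue⟦α, β⟧)
      (if Real.sin (2 * π * s) ≤ 0 then (2:ℝ) • deriv β (2 * s) else (2:ℝ) • deriv α (2 * s))
      s := by
  have h2 : HasDerivAt (fun s : ℝ => 2 * s) 2 s := by
    simpa using (hasDerivAt_id s).const_mul (2:ℝ)
  have hA : HasDerivAt (fun s => α (2 * s)) ((2:ℝ) • deriv α (2 * s)) s :=
    (hα.differentiable (2 * s)).hasDerivAt.scomp s h2
  have hB : HasDerivAt (fun s => β (2 * s)) ((2:ℝ) • deriv β (2 * s)) s :=
    (hβ.differentiable (2 * s)).hasDerivAt.scomp s h2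
  by_cases hz : Real.sin (2 * π * s) = 0
  · -- junction: both branches rest at the common base point
    obtain ⟨hαv, hαd⟩ := tautLoopLlc_junction hα hα0 hz
    obtain ⟨hβv, hβd⟩ := tautLoopLlc_junction hβ hβ0 hz
    have hite : (if Real.sin (2 * π * s) ≤ 0 then (2:ℝ) • deriv β (2 * s)
        else (2:ℝ) • deriv α (2 * s)) = 0 := by
      split_ifs <;> simp [hαd, hβd]
    rw [hite]
    rw [hαd, smul_zero] at hA
    rw [hβd, smul_zero] at hB
    exact tautLoopLlc_hasDerivAt_ite hB hA (by rw [hαv, hβv, h0])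
  · rcases lt_or_gt_of_ne hz with hneg | hpos
    · have hev : ∀ᶠ s' in 𝓝 s, Real.sin (2 * π * s') < 0 :=
        (by fun_prop : Continuous fun s' : ℝ => Real.sin (2 * π * s')).continuousAt.eventually_lt
          continuousAt_const hneg
      have heq : glue⟦α, β⟧ =ᶠ[𝓝 s] fun s' => β (2 * s') :=
        hev.mono fun s' hs' => by simp [hs'.le]
      rw [if_pos hneg.le]
      exact hB.congr_of_eventuallyEq heq
    · have hev : ∀ᶠ s' in 𝓝 s, 0 < Real.sin (2 * π * s') :=
        continuousAt_const.eventually_lt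
          (by fun_prop : Continuous fun s' : ℝ => Real.sin (2 * π * s')).continuousAt hpos
      have heq : glue⟦α, β⟧ =ᶠ[𝓝 s] fun s' => α (2 * s') :=
        hev.mono fun s' hs' => by simp [not_le.2 hs']
      rw [if_neg (not_le.2 hpos)]
      exact hA.congr_of_eventuallyEq heq

/-- **The glued loop is a `C¹` loop.** [folklore] -/
theorem tautLoopLlc_glue_isC1Loop {α β : ℝ → E3} (hα : IsC1Loop α) (hβ : IsC1Loop β)
    (h0 : α 0 = β 0) (hα0 : deriv α 0 = 0) (hβ0 : deriv β 0 = 0) :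
    IsC1Loop (glue⟦α, β⟧) := by
  have hd := tautLoopLlc_glue_hasDerivAt hα hβ h0 hα0 hβ0
  refine ⟨?_, fun s => ?_⟩
  · rw [contDiff_one_iff_deriv]
    refine ⟨fun s => (hd s).differentiableAt, ?_⟩
    have hderiv : deriv (glue⟦α, β⟧) = fun s => if Real.sin (2 * π * s) ≤ 0
        then (2:ℝ) • deriv β (2 * s) else (2:ℝ) • deriv α (2 * s) :=
      funext fun s => (hd s).deriv
    rw [hderiv]
    refine Continuous.if_le ?_ ?_ (by fun_prop) continuous_const fun s hs => ?_
    · exact (hβ.continuous_deriv.comp (by fun_prop : Continuous fun s : ℝ => 2 * s)).const_smul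
        (2:ℝ)
    · exact (hα.continuous_deriv.comp (by fun_prop : Continuous fun s : ℝ => 2 * s)).const_smul
        (2:ℝ)
    · rw [(tautLoopLlc_junction hα hα0 hs).2, (tautLoopLlc_junction hβ hβ0 hs).2]
  · show (if Real.sin (2 * π * (s + 1)) ≤ 0 then β (2 * (s + 1)) else α (2 * (s + 1))) =
      if Real.sin (2 * π * s) ≤ 0 then β (2 * s) else α (2 * s)
    have h1 : Real.sin (2 * π * (s + 1)) = Real.sin (2 * π * s) := by
      rw [show 2 * π * (s + 1) = 2 * π * s + 2 * π by ring, Real.sin_add_two_pi]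
    have h2 : β (2 * (s + 1)) = β (2 * s) := by
      rw [show (2:ℝ) * (s + 1) = 2 * s + 1 + 1 by ring, hβ.periodic, hβ.periodic]
    have h3 : α (2 * (s + 1)) = α (2 * s) := by
      rw [show (2:ℝ) * (s + 1) = 2 * s + 1 + 1 by ring, hα.periodic, hα.periodic]
    rw [h1, h2, h3]

/-- Splitting `∫₀¹` at `1/2` for an integrand which is a sped-up copy of `fa` on the first half
and of the `1`-periodic `fb` on the second half. [folklore] -/
theorem tautLoopLlc_integral_halves {F fa fb : ℝ → ℝ} (hF : Continuous F)
    (ha : ∀ s ∈ Ioo (0:ℝ) (1/2), F s = 2 * fa (2 * s))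
    (hb : ∀ s ∈ Ioo (1/2:ℝ) 1, F s = 2 * fb (2 * s)) (hper : Periodic fb 1) :
    ∫ s in (0:ℝ)..1, F s = (∫ s in (0:ℝ)..1, fa s) + ∫ s in (0:ℝ)..1, fb s := by
  rw [← integral_add_adjacent_intervals (hF.intervalIntegrable 0 (1/2))
    (hF.intervalIntegrable (1/2) 1)]
  congr 1
  · rw [integral_congr_Ioo_of_le (by norm_num : (0:ℝ) ≤ 1/2) ha,
      intervalIntegral.integral_const_mul]
    have h := intervalIntegral.smul_integral_comp_mul_left (a := 0) (b := 1/2) fa 2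
    rw [smul_eq_mul, mul_zero, show (2:ℝ) * (1/2) = 1 by norm_num] at h
    exact h
  · rw [integral_congr_Ioo_of_le (by norm_num : (1/2:ℝ) ≤ 1) hb,
      intervalIntegral.integral_const_mul]
    have h := intervalIntegral.smul_integral_comp_mul_left (a := 1/2) (b := 1) fb 2
    rw [smul_eq_mul, mul_one, show (2:ℝ) * (1/2) = 1 by norm_num] at h
    rw [h]
    have h' := hper.intervalIntegral_add_eq 1 0
    rw [zero_add, show (1:ℝ) + 1 = 2 by norm_num] at h'
    exact h'

/-- On the first half period the glue clock is positive: `sin (2πs) > 0` for `s ∈ (0, 1/2)`. [folklore] -/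
theorem tautLoopLlc_sin_pos_of_mem_Ioo {s : ℝ} (hs : s ∈ Ioo (0:ℝ) (1/2)) :
    0 < Real.sin (2 * π * s) :=
  Real.sin_pos_of_pos_of_lt_pi (by nlinarith [hs.1, Real.pi_pos])
    (by nlinarith [hs.2, Real.pi_pos])

/-- On the second half period the glue clock is negative: `sin (2πs) < 0` for `s ∈ (1/2, 1)`. [folklore] -/
theorem tautLoopLlc_sin_neg_of_mem_Ioo {s : ℝ} (hs : s ∈ Ioo (1/2:ℝ) 1) :
    Real.sin (2 * π * s) < 0 := by
  rw [show 2 * π * s = 2 * π * (s - 1) + 2 * π by ring, Real.sin_add_two_pi]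
  exact Real.sin_neg_of_neg_of_neg_pi_lt (by nlinarith [hs.2, Real.pi_pos])
    (by nlinarith [hs.1, Real.pi_pos])

/-- **Length of the glued loop** `= len α + len β`. [folklore] -/
theorem tautLoopLlc_glue_len {α β : ℝ → E3} (hα : IsC1Loop α) (hβ : IsC1Loop β)
    (h0 : α 0 = β 0) (hα0 : deriv α 0 = 0) (hβ0 : deriv β 0 = 0) :
    ∫ s in (0:ℝ)..1, ‖deriv (glue⟦α, β⟧) s‖ =
      (∫ s in (0:ℝ)..1, ‖deriv α s‖) + ∫ s in (0:ℝ)..1, ‖deriv β s‖ := by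
  have hd := tautLoopLlc_glue_hasDerivAt hα hβ h0 hα0 hβ0
  have hL := tautLoopLlc_glue_isC1Loop hα hβ h0 hα0 hβ0
  refine tautLoopLlc_integral_halves (F := fun s => ‖deriv (glue⟦α, β⟧) s‖)
    (fa := fun s => ‖deriv α s‖) (fb := fun s => ‖deriv β s‖) hL.continuous_deriv.norm
    (fun s hs => ?_) (fun s hs => ?_) (fun s => by simp [hβ.periodic_deriv s])
  · simp only [(hd s).deriv, if_neg (not_le.2 (tautLoopLlc_sin_pos_of_mem_Ioo hs)), norm_smul]
    norm_num
  · simp only [(hd s).deriv, if_pos (tautLoopLlc_sin_neg_of_mem_Ioo hs).le, norm_smul]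
    norm_num

/-- **Circulation around the glued loop** `= ∮_α + ∮_β`, for a continuous field. [folklore] -/
theorem tautLoopLlc_glue_circulation {v : E3 → E3} (hv : Continuous v) {α β : ℝ → E3}
    (hα : IsC1Loop α) (hβ : IsC1Loop β)
    (h0 : α 0 = β 0) (hα0 : deriv α 0 = 0) (hβ0 : deriv β 0 = 0) :
    circulation v (glue⟦α, β⟧) = circulation v α + circulation v β := by
  have hd := tautLoopLlc_glue_hasDerivAt hα hβ h0 hα0 hβ0
  have hL := tautLoopLlc_glue_isC1Loop hα hβ h0 hα0 hβ0
  unfold circulation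
  refine tautLoopLlc_integral_halves (F := fun s => ⟪v ((glue⟦α, β⟧) s), deriv (glue⟦α, β⟧) s⟫)
    (fa := fun s => ⟪v (α s), deriv α s⟫) (fb := fun s => ⟪v (β s), deriv β s⟫)
    ((hv.comp hL.continuous).inner hL.continuous_deriv)
    (fun s hs => ?_) (fun s hs => ?_) (fun s => by simp [hβ.periodic_deriv s, hβ.periodic s])
  · have hpos := tautLoopLlc_sin_pos_of_mem_Ioo hs
    simp only [(hd s).deriv, if_neg (not_le.2 hpos), real_inner_smul_right]
  · have hneg := tautLoopLlc_sin_neg_of_mem_Ioo hs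
    simp only [(hd s).deriv, if_pos hneg.le, real_inner_smul_right]

/-- **Tools stub, part 1** (registered as `stub_tautLoopLlcTools`): the conjunction of the
shift invariance of the length, the stopping reparametrisation lemmas and the gluing lemmas above,
with all binders explicit. [folklore] -/
theorem stub_tautLoopLlcTools :
    (∀ (γ : ℝ → EuclideanSpace ℝ (Fin 3)), Function.Periodic γ 1 → ∀ a : ℝ, (∫ s in (0:ℝ)..1,
      ‖deriv (fun s => γ (s + a)) s‖) = ∫ s in (0:ℝ)..1, ‖deriv γ s‖) ∧ (∀ (v : EuclideanSpace
      ℝ (Fin 3) → EuclideanSpace ℝ (Fin 3)) (γ : ℝ → EuclideanSpace ℝ (Fin 3)),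
      Literature.Analysis.FluidPDE.IsC1Loop γ → ∀ a : ℝ, Literature.Analysis.FluidPDE.IsC1Loop
      (fun s : ℝ => γ (a + (s - Real.sin (2 * Real.pi * s) / (2 * Real.pi)))) ∧ (fun s : ℝ => γ
      (a + (s - Real.sin (2 * Real.pi * s) / (2 * Real.pi)))) 0 = γ a ∧ deriv (fun s : ℝ => γ
      (a + (s - Real.sin (2 * Real.pi * s) / (2 * Real.pi)))) 0 = 0 ∧
      Literature.Analysis.FluidPDE.circulation v (fun s : ℝ => γ (a + (s - Real.sin (2 *
      Real.pi * s) / (2 * Real.pi)))) = Literature.Analysis.FluidPDE.circulation v γ ∧ (∫ s in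
      (0:ℝ)..1, ‖deriv (fun s : ℝ => γ (a + (s - Real.sin (2 * Real.pi * s) / (2 * Real.pi))))
      s‖) = ∫ s in (0:ℝ)..1, ‖deriv γ s‖) ∧ (∀ (v : EuclideanSpace ℝ (Fin 3) → EuclideanSpace ℝ
      (Fin 3)), Continuous v → ∀ (α β : ℝ → EuclideanSpace ℝ (Fin 3)),
      Literature.Analysis.FluidPDE.IsC1Loop α → Literature.Analysis.FluidPDE.IsC1Loop β → α 0 =
      β 0 → deriv α 0 = 0 → deriv β 0 = 0 → (∀ s : ℝ, HasDerivAt (fun s : ℝ => if Real.sin (2 *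
      Real.pi * s) ≤ 0 then β (2 * s) else α (2 * s)) (if Real.sin (2 * Real.pi * s) ≤ 0 then
      (2:ℝ) • deriv β (2 * s) else (2:ℝ) • deriv α (2 * s)) s) ∧
      Literature.Analysis.FluidPDE.IsC1Loop (fun s : ℝ => if Real.sin (2 * Real.pi * s) ≤ 0
      then β (2 * s) else α (2 * s)) ∧ (∫ s in (0:ℝ)..1, ‖deriv (fun s : ℝ => if Real.sin (2 *
      Real.pi * s) ≤ 0 then β (2 * s) else α (2 * s)) s‖) = (∫ s in (0:ℝ)..1, ‖deriv α s‖) + (∫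
      s in (0:ℝ)..1, ‖deriv β s‖) ∧ Literature.Analysis.FluidPDE.circulation v (fun s : ℝ => if
      Real.sin (2 * Real.pi * s) ≤ 0 then β (2 * s) else α (2 * s)) =
      Literature.Analysis.FluidPDE.circulation v α + Literature.Analysis.FluidPDE.circulation v
      β) :=
  ⟨fun _γ hγ a => tautLoopLlc_len_comp_add_const hγ a,
    fun v _γ hγ a => ⟨(tautLoopLlc_stop_isC1Loop hγ a).1, (tautLoopLlc_stop_isC1Loop hγ a).2.1,
      (tautLoopLlc_stop_isC1Loop hγ a).2.2, tautLoopLlc_stop_circulation v hγ a,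
      tautLoopLlc_stop_len hγ a⟩,
    fun _v hv _α _β hα hβ h0 hα0 hβ0 => ⟨tautLoopLlc_glue_hasDerivAt hα hβ h0 hα0 hβ0,
      tautLoopLlc_glue_isC1Loop hα hβ h0 hα0 hβ0, tautLoopLlc_glue_len hα hβ h0 hα0 hβ0,
      tautLoopLlc_glue_circulation hv hα hβ h0 hα0 hβ0⟩⟩

end Summit.NavierStokesRegularity.NavierStokesRegularity.Theorems

end
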